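import Summits.KontsevichZagierPeriods.KontsevichZagierPeriods.Theorems.FurushoPentagonPentagonInKZGroupLike

/-!
# `PentagonInKZ`, line `logfree-gauge-corner-flatness`: first-letter stripping through `regEnd`

Stub `regEnd_apply_cons` of the crux `FurushoPentagon.PentagonInKZ`
(stmt-KontsevichZagierPeriods-11348).  Pure algebra over a general alphabet `α`.

IKZ's end regularisation `regEnd x W = Σ_{k ≤ n} (-1)^k xᵏ ш (W minus its last k letters)`
(`Shuffle.regEnd`, `n` = number of trailing `x`'s) is, coefficientwise, the end Taylor
(constant-term) map `τ_{|W|+1}(W) = Σ_k (-1)^k xᵏ ш ∂ₓᵏ W` of the derivation `∂ₓ` ("remove a final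
`x`") of the completed shuffle algebra (`GroupLike.regEnd_apply_eq_endTaylor`).  Stripping the
FIRST letter `ℓ` of every word is the derivation `ℓ∂ = dFront ℓ`, which commutes with `∂ₓ` and
satisfies `ℓ∂(xᵏ⁺¹) = [ℓ = x] xᵏ`; the Leibniz rule therefore gives the commutation formula

  `ℓ∂ ∘ τ_{N+1} = τ_{N+1} ∘ ℓ∂ - [ℓ = x] · τ_N ∘ ∂ₓ`   (`RegEndCons.dFront_endTaylor`),

and on the word `W` this is the registered identity

  `regEnd x W (ℓ :: v) = [W = ℓ W'] regEnd x W' v - [ℓ = x] [W = U x] regEnd x U v`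

(the gauged transport equation `∂_β Q = Ω Q - Q · x/β` of end-regularised iterated integrals).

References: K. Ihara, M. Kaneko, D. Zagier, Compos. Math. 142 (2006), §2 Prop. 1, §3, Cor. 5;
C. Reutenauer, *Free Lie algebras* (1993), §1.4.
-/

noncomputable section

open scoped BigOperators
open Literature.NumberTheory.Transcendental

namespace Summit.KontsevichZagierPeriods.FurushoPentagon.PentagonInKZ

namespace RegEndCons

open ShuffleAlgebra

variable {α : Type*} {R : Type*} [CommRing R]

/-- The two elementary derivations commute: `ᵦ∂ ∂ₐ = ∂ₐ ᵦ∂`. [folklore] -/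
theorem dFront_dEnd (a b : α) (f : ShuffleAlgebra α R) :
    dFront b (dEnd a f) = dEnd a (dFront b f) := by
  ext w; rfl

/-- `ᵦ∂` commutes with the iterates `∂ₐᵏ`. [folklore] -/
theorem dFront_dEnd_iterate (a b : α) (k : ℕ) (f : ShuffleAlgebra α R) :
    dFront b ((dEnd a)^[k] f) = (dEnd a)^[k] (dFront b f) := by
  induction k generalizing f with
  | zero => rfl
  | succ k ih => rw [Function.iterate_succ_apply, Function.iterate_succ_apply, ← dFront_dEnd, ih]

/-- `ᵦ∂ ((-1)ᵏ f) = (-1)ᵏ ᵦ∂ f`. [folklore] -/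
theorem dFront_neg_one_pow_mul (b : α) (k : ℕ) (f : ShuffleAlgebra α R) :
    dFront b ((-1) ^ k * f) = (-1) ^ k * dFront b f := by
  rcases neg_one_pow_eq_or (ShuffleAlgebra α R) k with h | h <;> rw [h]
  · rw [one_mul, one_mul]
  · rw [neg_one_mul, neg_one_mul, map_neg]

/-- The Taylor map of a Taylor system kills `0`. [folklore] -/
theorem taylor_zero {A : Type*} [CommRing A] (T : TaylorSystem A) (N : ℕ) : T.taylor N 0 = 0 := by
  unfold TaylorSystem.taylor
  exact Finset.sum_eq_zero fun k _ => by rw [iterate_map_zero, mul_zero, mul_zero]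

variable [DecidableEq α]

/-- `ᵦ∂ (∅) = 0`: the empty word has no first letter. [folklore] -/
theorem dFront_word_nil (b : α) : dFront b (word ([] : List α) : ShuffleAlgebra α R) = 0 :=
  dFront_word_of_ne b (by simp)

/-- `ₓ∂ (xᵏ⁺¹) = xᵏ`. [folklore] -/
theorem dFront_word_replicate_succ_self (x : α) (k : ℕ) :
    dFront x (word (List.replicate (k + 1) x) : ShuffleAlgebra α R) = word (List.replicate k x) := by
  rw [List.replicate_succ]
  exact dFront_word_cons x _

/-- `ℓ∂ (xᵏ) = 0` for a letter `ℓ ≠ x`. [folklore] -/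
theorem dFront_word_replicate_of_ne {x ℓ : α} (h : ℓ ≠ x) (k : ℕ) :
    dFront ℓ (word (List.replicate k x) : ShuffleAlgebra α R) = 0 := by
  refine dFront_word_of_ne ℓ ?_
  cases k with
  | zero => simp
  | succ k =>
    rw [List.replicate_succ, List.head?_cons, Ne, Option.some.injEq]
    exact fun e => h e.symm

/-- **First-letter stripping through the end Taylor map**: since `ℓ∂` is a derivation commuting
with `∂ₓ` and `ℓ∂(xᵏ⁺¹) = [ℓ = x] xᵏ`, the Leibniz rule gives
`ℓ∂ (τ_{N+1} f) = τ_{N+1} (ℓ∂ f) - [ℓ = x] τ_N (∂ₓ f)` (the sum over `k ≥ 1` re-indexes to the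
Taylor sum of `∂ₓ f` with the opposite sign). [cite: IharaKanekoZagier2006, Cor. 5 (mirror image)] -/
theorem dFront_endTaylor (x ℓ : α) (N : ℕ) (f : ShuffleAlgebra α R) :
    dFront ℓ ((endSystem x).taylor (N + 1) f) =
      (endSystem x).taylor (N + 1) (dFront ℓ f) -
        if ℓ = x then (endSystem x).taylor N (dEnd x f) else 0 := by
  -- the Leibniz rule, term by term
  have hterm : ∀ k : ℕ, dFront ℓ ((-1) ^ k * (word (List.replicate k x) * (dEnd x)^[k] f) :
      ShuffleAlgebra α R) =
      (-1) ^ k * (dFront ℓ (word (List.replicate k x)) * (dEnd x)^[k] f) +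
        (-1) ^ k * (word (List.replicate k x) * (dEnd x)^[k] (dFront ℓ f)) := by
    intro k
    rw [dFront_neg_one_pow_mul, dFront_mul, dFront_dEnd_iterate, mul_add]
  -- the first family of terms: `Σ_{k ≤ N} (-1)^k ℓ∂(xᵏ) ∂ₓᵏ f = -[ℓ = x] τ_N (∂ₓ f)`
  have hA : ∑ k ∈ Finset.range (N + 1),
      ((-1 : ShuffleAlgebra α R) ^ k * (dFront ℓ (word (List.replicate k x)) * (dEnd x)^[k] f)) =
      -(if ℓ = x then (endSystem x).taylor N (dEnd x f) else 0) := by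
    rw [Finset.sum_range_succ', List.replicate_zero, dFront_word_nil, zero_mul, mul_zero, add_zero]
    split_ifs with hℓ
    · subst hℓ
      rw [TaylorSystem.taylor, ← Finset.sum_neg_distrib]
      refine Finset.sum_congr rfl fun k _ => ?_
      rw [dFront_word_replicate_succ_self, Function.iterate_succ_apply, endSystem_D, endSystem_t,
        pow_succ]
      ring
    · rw [neg_zero]
      exact Finset.sum_eq_zero fun k _ => by
        rw [dFront_word_replicate_of_ne hℓ, zero_mul, mul_zero]
  calc dFront ℓ ((endSystem x).taylor (N + 1) f)
      = ∑ k ∈ Finset.range (N + 1),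
          dFront ℓ ((-1) ^ k * (word (List.replicate k x) * (dEnd x)^[k] f)) := by
        rw [TaylorSystem.taylor, map_sum]; rfl
    _ = ∑ k ∈ Finset.range (N + 1),
          ((-1 : ShuffleAlgebra α R) ^ k *
            (dFront ℓ (word (List.replicate k x)) * (dEnd x)^[k] f)) +
        ∑ k ∈ Finset.range (N + 1),
          ((-1 : ShuffleAlgebra α R) ^ k *
            (word (List.replicate k x) * (dEnd x)^[k] (dFront ℓ f))) := by
        rw [← Finset.sum_add_distrib]
        exact Finset.sum_congr rfl fun k _ => hterm k
    _ = (endSystem x).taylor (N + 1) (dFront ℓ f) -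
        if ℓ = x then (endSystem x).taylor N (dEnd x f) else 0 := by
        rw [hA, TaylorSystem.taylor, neg_add_eq_sub]
        rfl

end RegEndCons

open ShuffleAlgebra GroupLike RegEndCons in
/-- **Stub `regEnd_apply_cons`**: how stripping the first letter interacts with IKZ's end
regularisation `regEnd x W = Σ_k (-1)^k xᵏ ш (W minus its last k letters)`: it commutes with
stripping the first letter of `W`, up to one extra term `- regEnd x (W.dropLast)` when `ℓ = x`
and `W` ends in `x`:
`regEnd x W (ℓ :: v) = [W = ℓ W'] regEnd x W' v - [ℓ = x ∧ W = U x] regEnd x U v`.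
Coefficientwise this is the derivation identity `ℓ∂ ∘ τ = τ ∘ ℓ∂ - [ℓ = x] τ ∘ ∂ₓ` for the end
Taylor map of the completed shuffle algebra (`RegEndCons.dFront_endTaylor`); analytically it is
the gauged transport equation `∂_β Q = Ω Q - Q·x/β` of end-regularised iterated integrals.
[cite: IharaKanekoZagier2006, Cor. 5 (mirror image)] -/
theorem regEnd_apply_cons : ∀ (α : Type) [DecidableEq α] (x ℓ : α) (W v : List α), Shuffle.regEnd x W (ℓ :: v) = (if W.head? = some ℓ then Shuffle.regEnd x W.tail v else 0) - (if ℓ = x ∧ W.getLast? = some x then Shuffle.regEnd x W.dropLast v else 0) := by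
  intro α _ x ℓ W v
  rw [regEnd_apply_eq_endTaylor, ← dFront_apply, dFront_endTaylor, ShuffleAlgebra.sub_apply]
  congr 1
  · -- `τ_{|W|+1} (ℓ∂ W) v = [W = ℓ W'] regEnd x W' v`
    cases W with
    | nil => rw [dFront_word_nil, taylor_zero, ShuffleAlgebra.zero_apply, if_neg (by simp)]
    | cons a W =>
      by_cases ha : a = ℓ
      · subst ha
        rw [dFront_word_cons, List.length_cons,
          (endSystem x).taylor_eq_of_le (dEnd_iterate_word_eq_zero x W) (by omega),
          ← regEnd_apply_eq_endTaylor, List.head?_cons, if_pos rfl, List.tail_cons]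
      · have hne : (a :: W).head? ≠ some ℓ := by
          rw [List.head?_cons, Ne, Option.some.injEq]; exact ha
        rw [dFront_word_of_ne ℓ hne, taylor_zero, ShuffleAlgebra.zero_apply, if_neg hne]
  · -- `[ℓ = x] τ_{|W|} (∂ₓ W) v = [ℓ = x ∧ W = U x] regEnd x U v`
    by_cases hℓ : ℓ = x
    · subst hℓ
      rw [if_pos rfl]
      by_cases hW : W.getLast? = some ℓ
      · obtain ⟨U, rfl⟩ := List.getLast?_eq_some_iff.mp hW
        rw [if_pos ⟨rfl, hW⟩, dEnd_word_append, List.length_append, List.length_singleton,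
          ← regEnd_apply_eq_endTaylor, List.dropLast_concat]
      · rw [if_neg fun h => hW h.2, dEnd_word_of_ne ℓ hW, taylor_zero, ShuffleAlgebra.zero_apply]
    · rw [if_neg hℓ, if_neg fun h => hℓ h.1, ShuffleAlgebra.zero_apply]

end Summit.KontsevichZagierPeriods.FurushoPentagon.PentagonInKZ
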